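import Summits.QuantumFields.BalabanUV.T4Continuum.Support.VariationalEffectiveHilbert
import Summits.QuantumFields.BalabanUV.T4Continuum.Support.VariationalColourScalarPair

/-!
# T⁴ programme, spine node NE2 (U1a), lane P2 — SUPPLIER ITEM «D-E», part 2: THE COLOUR CANONICAL PAIR HAS AN EFFECTIVE OPERATOR — leaf D for the
# E-valued 0-form sector (`VariationalColourScalarPair`, p215316) by the flattening of part 1, and its η-rate currency modulo the colour brackets

NE2 formalisation swarm `b2b-balaban-t4-ne2-formalise-*`, leaf prover 02 (gen 4); journal INTENT «D-E» (CLAIMS.log 2026-08-20T13:58Z).  Part 1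
(`VariationalEffectiveHilbert`): for ANY ℂ-linear onto constraint and PSD-matrix form on E-valued fields, coercive in leaf P's shape, the block-spin value
is the Hermitian form of `effOp K (matE b Q) a` on the flattened unit index, and towers of such problems inherit `OneStepAveragedLaw` ∕ `TowerLimitRate`
from their brackets.  HERE the colour canonical pair is shown to be such a problem:
 * §1 the transported block average `Qcv n M T` (V-COL-FED p214930) IS ℂ-linear — `QcvLin`; the covariant bond difference `cDv` IS ℂ-linear into
   `Tor × Fin d`-indexed fields — `cDvLin`; hence **`Scv_eq_qform`**: `Scv n M Rc f = qform (KC n M Rc b) (flatE b f)` with the PSD matrix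
   `KC := (n²∕n^d) • (matE b cDvLin)ᴴ·(matE b cDvLin)` (Gram, part 1 §2);
 * §2 **`blockSpin_Scv_eq`**: under leaf P⁺-colour's shape `qWv f ≤ C_P·(Scv f + nsqv (Qkv T f))` (p216531 `qWv_le_coarse_local` supplies it frame-free) and
   site operators with a right inverse (`T∘S = 1`, so `Qkv T` is onto by leaf-03-g4's `Qcv_comp` p215022),
   `blockSpin (Qkv n M T) (Scv n M Rc) μ = re⟨flatE b μ, effC n M Rc T b a · flatE b μ⟩`, `effC` HERMITIAN — the COLOUR EFFECTIVE OPERATOR on `Tor M × κ`;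
 * §3 **`towerLimitRate_effC`**: along `n_k = L^k` with data `(Rc k, T k)`, colour-P⁺ coercivity per level and the two one-sided brackets of
   `colour_pair_bracket` (p215316) with GEOMETRIC defects ⟹ `TowerLimitRate (fun _ ↦ 1) 1 (k ↦ effC (L^k) M (Rc k) (T k) b a) C ρ` — row NE2's
   η-rate currency for the COLOUR 0-form species MODULO the colour brackets (whose FED⁺∕UB⁺∕P⁺∕ONE⁺ suppliers are landed; REG⁺-colour open).
The vector pair at general `E` (`QvL`, `ScV`) is the same exercise on the product carrier `Tor × Fin d → E` (sequel).

HONEST FRAMING (T4-DAG p. 1).  Model level (operators DATA, c5); [folklore] linear algebra; data `def`s `QcvLin`, `cDvLin`, `KC`, `effC` only, no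
`def … : Prop`, no `sorry`; axioms standard.  Nothing of NE2 is proved here: the brackets are HYPOTHESES.  NE2 NOT proved; spine PROVED 0∕9; rung (B)+1
finite T⁴ — NOT infinite volume, NOT a mass gap, NOT Clay.  HONEST DEPENDENCY (cell, verbatim): continuum YM on T⁴ ⇐ BetaPertH ∧ nine spine estimates
(0/9 proved); BetaPertH ⇐ (D1) ∧ (D4) ∧ CAP+tail; G-an2-4 gates asym, D1 and NE2/3/4.
-/

noncomputable section

namespace Summit.QuantumFields.BalabanUV.T4Continuum.VariationalEffectiveHilbertPairs

open Finset
open scoped Matrix ComplexConjugate ComplexOrder Matrix.Norms.L2Operator BigOperators InnerProductSpace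
open Literature.MathematicalPhysics.QuantumFieldTheory.Balaban1983to89
open Literature.MathematicalPhysics.QuantumFieldTheory.Balaban1983to89.B5Prop11Plancherel (Tor fine unitVec)
open Literature.MathematicalPhysics.QuantumFieldTheory.Balaban1983to89.B5Block118 (bpt)
open Literature.MathematicalPhysics.QuantumFieldTheory.Balaban1983to89.B5Prop11Lower (nsq nsq_nonneg)
open Literature.Analysis.Complex (qform qform_smul qform_nonneg_of_posSemidef)
open Summit.QuantumFields.BalabanUV.T4Continuum.VariationalTransfer (blockSpin)
open Summit.QuantumFields.BalabanUV.T4Continuum.VariationalEffectiveOperator (effOp)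
open Summit.QuantumFields.BalabanUV.T4Continuum.CovariantAveragingTower (TowerLimitRate)
open Summit.QuantumFields.BalabanUV.T4Continuum.VariationalColourFederbush (cDv dirUv Qcv)
open Summit.QuantumFields.BalabanUV.T4Continuum.VariationalColourUpperBound (nsqv comp Qcv_comp)
open Summit.QuantumFields.BalabanUV.T4Continuum.VariationalColourScalarPair (Scv qWv Qkv Scv_nonneg)
open Summit.QuantumFields.BalabanUV.T4Continuum.VariationalEffectiveHilbert

variable {d : ℕ} {E : Type*} [NormedAddCommGroup E] [InnerProductSpace ℂ E]
variable {κ : Type*} [Fintype κ] [DecidableEq κ]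

/-! ## §1 The colour carriers are linear; the colour form is a Gram form after flattening -/

section Linear

variable (L : ℕ) [NeZero L] (N : Fin d → ℕ) [∀ μ, NeZero (N μ)]

/-- the transported block average `Qcv L N T′` as a ℂ-LINEAR map of `E`-valued fields. [folklore] -/
def QcvLin (T' : Tor (fine L N) → (E →L[ℂ] E)) : (Tor (fine L N) → E) →ₗ[ℂ] (Tor N → E) where
  toFun := Qcv L N T'
  map_add' f g := by
    funext y
    simp only [Qcv, Pi.add_apply, map_add, Finset.sum_add_distrib, smul_add]
  map_smul' c f := by
    funext y
    simp only [Qcv, Pi.smul_apply, map_smul, RingHom.id_apply, ← Finset.smul_sum, smul_comm c]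

omit [NeZero L] [∀ μ, NeZero (N μ)] in
/-- `QcvLin` acts as `Qcv`. [folklore] -/
@[simp] theorem QcvLin_apply (T' : Tor (fine L N) → (E →L[ℂ] E)) (f : Tor (fine L N) → E) : QcvLin L N T' f = Qcv L N T' f := rfl

/-- the covariant bond difference `cDv N Rc` as a ℂ-LINEAR map into `Tor N × Fin d`-indexed fields. [folklore] -/
def cDvLin (Rc : Tor N → Fin d → (E →L[ℂ] E)) : (Tor N → E) →ₗ[ℂ] (Tor N × Fin d → E) where
  toFun f p := cDv N Rc f p.1 p.2
  map_add' f g := by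
    funext p
    simp only [cDv, Pi.add_apply, map_add]
    abel
  map_smul' c f := by
    funext p
    simp only [cDv, Pi.smul_apply, map_smul, RingHom.id_apply, smul_sub]

omit [∀ μ, NeZero (N μ)] in
/-- `cDvLin` acts as `cDv`. [folklore] -/
@[simp] theorem cDvLin_apply (Rc : Tor N → Fin d → (E →L[ℂ] E)) (f : Tor N → E) (p : Tor N × Fin d) :
    cDvLin N Rc f p = cDv N Rc f p.1 p.2 := rfl

/-- `Σ_μ dirUv Rc f μ = Σ_p ‖cDvLin Rc f p‖²` (order of summation). [folklore] -/
theorem sum_dirUv_eq (Rc : Tor N → Fin d → (E →L[ℂ] E)) (f : Tor N → E) :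
    ∑ μ, dirUv N Rc f μ = ∑ p : Tor N × Fin d, ‖cDvLin N Rc f p‖ ^ 2 := by
  rw [Fintype.sum_prod_type, Finset.sum_comm]
  rfl

end Linear

section Colour

variable (n : ℕ) [NeZero n] (M : Fin d → ℕ) [hM : ∀ μ, NeZero (M μ)]

/-- **THE MATRIX OF THE COLOUR FORM** on the flattened index `Tor (fine n M) × κ`: `KC := (n²∕n^d) • (matE b cDvLin)ᴴ·(matE b cDvLin)`. [folklore] -/
def KC (Rc : Tor (fine n M) → Fin d → (E →L[ℂ] E)) (b : OrthonormalBasis κ ℂ E) :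
    Matrix (Tor (fine n M) × κ) (Tor (fine n M) × κ) ℂ :=
  (((n : ℝ) ^ 2 / (n : ℝ) ^ d : ℝ) : ℂ) • ((matE b (cDvLin (fine n M) Rc))ᴴ * matE b (cDvLin (fine n M) Rc))

/-- `KC` is positive semidefinite. [folklore] -/
theorem KC_posSemidef (Rc : Tor (fine n M) → Fin d → (E →L[ℂ] E)) (b : OrthonormalBasis κ ℂ E) : (KC n M Rc b).PosSemidef := by
  unfold KC
  exact Matrix.PosSemidef.smul (Matrix.posSemidef_conjTranspose_mul_self _) (Complex.zero_le_real.mpr (by positivity))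

/-- **`Scv = qform KC ∘ flatE b`**. [folklore] -/
theorem Scv_eq_qform (Rc : Tor (fine n M) → Fin d → (E →L[ℂ] E)) (b : OrthonormalBasis κ ℂ E) (f : Tor (fine n M) → E) :
    Scv n M Rc f = qform (KC n M Rc b) (flatE b f) := by
  rw [KC, qform_smul, ← sum_norm_sq_eq_qform_gram, ← sum_dirUv_eq]
  rfl

/-- leaf P⁺-colour's shape gives the coercivity of part 1 §3 for `(QcvLin, Scv)` with `C₁ = C₂ = n^d·C_P`. [folklore] -/
theorem coercive_of_colourP {Rc : Tor (fine n M) → Fin d → (E →L[ℂ] E)} {T : Tor (fine n M) → (E →L[ℂ] E)} {CP : ℝ}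
    (hP : ∀ f, qWv n M f ≤ CP * (Scv n M Rc f + nsqv (Qkv n M T f))) (f : Tor (fine n M) → E) :
    ∑ x, ‖f x‖ ^ 2 ≤ (n : ℝ) ^ d * CP * ∑ z, ‖QcvLin n M T f z‖ ^ 2 + (n : ℝ) ^ d * CP * Scv n M Rc f := by
  have hn : (0 : ℝ) < (n : ℝ) ^ d := by have := NeZero.ne n; positivity
  have h := mul_le_mul_of_nonneg_left (hP f) hn.le
  unfold qWv at h
  rw [← mul_assoc, mul_inv_cancel₀ hn.ne', one_mul] at h
  have e : (n : ℝ) ^ d * (CP * (Scv n M Rc f + nsqv (Qkv n M T f)))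
      = (n : ℝ) ^ d * CP * ∑ z, ‖QcvLin n M T f z‖ ^ 2 + (n : ℝ) ^ d * CP * Scv n M Rc f := by
    rw [QcvLin_apply]; unfold nsqv Qkv; ring
  rw [← e]
  exact h

/-- site operators with a right inverse make the colour average onto (`Qcv_comp`, p215022). [folklore] -/
theorem QcvLin_surjective {T S : Tor (fine n M) → (E →L[ℂ] E)} (hTS : ∀ x v, T x (S x v) = v) :
    Function.Surjective (QcvLin n M T : (Tor (fine n M) → E) →ₗ[ℂ] (Tor M → E)) :=
  fun φ => ⟨comp n M S φ, by rw [QcvLin_apply, Qcv_comp n M hTS]⟩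

/-- **THE COLOUR EFFECTIVE OPERATOR** on the flattened unit index `Tor M × κ`. [folklore] -/
def effC (Rc : Tor (fine n M) → Fin d → (E →L[ℂ] E)) (T : Tor (fine n M) → (E →L[ℂ] E)) (b : OrthonormalBasis κ ℂ E) (a : ℝ) :
    Matrix (Tor M × κ) (Tor M × κ) ℂ :=
  effOp (KC n M Rc b) (matE b (QcvLin n M T)) a

/-! ## §2 The colour block-spin value is the form of `effC` -/

/-- **LEAF D FOR THE COLOUR PAIR**: under `T∘S = 1` and leaf P⁺-colour's shape, `blockSpin (Qkv n M T) (Scv n M Rc) μ = re⟨flatE b μ, effC · flatE b μ⟩`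
(any `a > 0`). [folklore] -/
theorem blockSpin_Scv_eq {Rc : Tor (fine n M) → Fin d → (E →L[ℂ] E)} {T S : Tor (fine n M) → (E →L[ℂ] E)} (hTS : ∀ x v, T x (S x v) = v)
    {CP : ℝ} (hP : ∀ f, qWv n M f ≤ CP * (Scv n M Rc f + nsqv (Qkv n M T f))) (b : OrthonormalBasis κ ℂ E) {a : ℝ} (ha : 0 < a)
    (μ : Tor M → E) :
    blockSpin (Qkv n M T) (Scv n M Rc) μ = (star (flatE b μ) ⬝ᵥ (effC n M Rc T b a *ᵥ flatE b μ)).re :=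
  blockSpin_eq_effE b (Q := QcvLin n M T) (QcvLin_surjective n M hTS) (KC_posSemidef n M Rc b) (S := Scv n M Rc)
    (Scv_eq_qform n M Rc b) (coercive_of_colourP n M hP) ha μ

/-- `effC` is Hermitian. [folklore] -/
theorem effC_isHermitian {Rc : Tor (fine n M) → Fin d → (E →L[ℂ] E)} {T S : Tor (fine n M) → (E →L[ℂ] E)} (hTS : ∀ x v, T x (S x v) = v)
    {CP : ℝ} (hP : ∀ f, qWv n M f ≤ CP * (Scv n M Rc f + nsqv (Qkv n M T f))) (b : OrthonormalBasis κ ℂ E) {a : ℝ} (ha : 0 < a) :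
    (effC n M Rc T b a).IsHermitian :=
  effE_isHermitian b (Q := QcvLin n M T) (QcvLin_surjective n M hTS) (KC_posSemidef n M Rc b) (S := Scv n M Rc)
    (Scv_eq_qform n M Rc b) (coercive_of_colourP n M hP) ha

end Colour

/-! ## §3 The colour tower: row NE2's η-rate currency for the colour species, modulo the colour brackets -/

section Tower

variable (L : ℕ) [NeZero L] (M : Fin d → ℕ) [hM : ∀ μ, NeZero (M μ)]
variable (Rc : (k : ℕ) → Tor (fine (L ^ k) M) → Fin d → (E →L[ℂ] E))
variable (T S : (k : ℕ) → Tor (fine (L ^ k) M) → (E →L[ℂ] E))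

/-- **ROW NE2's η-RATE CURRENCY FOR THE COLOUR 0-FORM SPECIES, MODULO THE COLOUR BRACKETS**: along `n_k = L^k` with site operators having right
inverses (`T k ∘ S k = 1`), leaf P⁺-colour per level, and the two one-sided brackets of `colour_pair_bracket` (p215316) with defects `≤ C·ρ^k`, `ρ < 1`
⟹ `TowerLimitRate (fun _ ↦ 1) 1 (k ↦ effC (L^k) M (Rc k) (T k) b a) C ρ` on `Tor M × κ`: the colour effective operators converge at rate `ρ`. [folklore] -/
theorem towerLimitRate_effC (hTS : ∀ k x v, T k x (S k x v) = v) {CP : ℕ → ℝ}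
    (hP : ∀ k f, qWv (L ^ k) M f ≤ CP k * (Scv (L ^ k) M (Rc k) f + nsqv (Qkv (L ^ k) M (T k) f)))
    (b : OrthonormalBasis κ ℂ E) {a : ℝ} (ha : 0 < a) {C ρ : ℝ} (hC : 0 ≤ C) (hρ : 0 ≤ ρ) (hρ1 : ρ < 1) (e e' : ℕ → ℝ)
    (he : ∀ k, e k ≤ C * ρ ^ k) (he' : ∀ k, e' k ≤ C * ρ ^ k)
    (hbr : ∀ k (μ : Tor M → E),
      blockSpin (Qkv (L ^ k) M (T k)) (Scv (L ^ k) M (Rc k)) μ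
          ≤ blockSpin (Qkv (L ^ (k + 1)) M (T (k + 1))) (Scv (L ^ (k + 1)) M (Rc (k + 1))) μ + e k * nsqv μ ∧
        blockSpin (Qkv (L ^ (k + 1)) M (T (k + 1))) (Scv (L ^ (k + 1)) M (Rc (k + 1))) μ
          ≤ blockSpin (Qkv (L ^ k) M (T k)) (Scv (L ^ k) M (Rc k)) μ + e' k * nsqv μ) :
    TowerLimitRate (ι := fun _ => Tor M × κ) (fun _ => (1 : Matrix (Tor M × κ) (Tor M × κ) ℂ)) 1
      (fun k => effC (L ^ k) M (Rc k) (T k) b a) C ρ :=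
  towerLimitRate_effE b (fun k => QcvLin (L ^ k) M (T k)) (fun k => KC (L ^ k) M (Rc k) b) (fun k => Scv (L ^ k) M (Rc k))
    (fun k => QcvLin_surjective (L ^ k) M (hTS k)) (fun k => KC_posSemidef (L ^ k) M (Rc k) b)
    (fun k f => Scv_eq_qform (L ^ k) M (Rc k) b f) (fun k f => coercive_of_colourP (L ^ k) M (hP k) f) ha hC hρ hρ1 e e' he he'
    (fun k μ => hbr k μ)

end Tower

end Summit.QuantumFields.BalabanUV.T4Continuum.VariationalEffectiveHilbertPairs

end
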